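/-
Copyright: statement-level skeleton of a published paper (lit-balaban cell, Phase-2 proof seat p25, gen 15; v1.1 header
quotation repair gen 16, declarations byte-identical). No proof claims beyond what the kernel checks below.
-/
import Literature.MathematicalPhysics.QuantumFieldTheory.BalabanImbrieJaffe1984to88.BIJ88VertexRemainder312
import Mathlib.MeasureTheory.Function.L2Space

/-!
# `BalabanImbrieJaffe1984to88.BIJ88VertexChiShell312` — T. Bałaban, J. Imbrie, A. Jaffe, *Effective action and cluster
properties of the abelian Higgs model*, Commun. Math. Phys. **114** (1988) 257–315 [BalabanImbrieJaffe1988], §5.14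
p. 311–312 [PDF 55–56] *"The components containing contractions to χ′_{Λ^{(k)}} … are called remainder components"*,
p. 309 [PDF 53] *"Each t-derivative of a χ-factor in χ^{(k)}_{w.f.} gives at least a factor e^{β(L^kε/ε_0)^{1/4−α}}. This
follows because with χ′(l, x) = d/dx χ(l, x), we have … and similarly the n-th derivative in t of χ(cp(e_k), A^{(k)})
is bounded by t^{−n} times a function bounded by a constant and supported in c_1 p(te_k) ≦ |A^{(k)}| ≦ c_2 p(te_k).
After integration over A^{(k)}, we obtain factors c t^{−n} e^{−cp(te_k)^2} …"* (v1.1, ref-5 DF-g48-2: these are the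
printed p. 309 sentences, text layer p0053 L21–28; the v1.0 header carried at this place a sentence that is NOT in
print — withdrawn; any exponent displayed in this file other than the quoted `c t^{−n} e^{−cp(te_k)^2}` is this
file's own paraphrase, not print's)
— **THE `χ′` SMALL FACTOR OF THE VERTEX EXPANSION, BY CAUCHY–SCHWARZ**: every `χ′`-term of p25 gen 15's one-component
expansion (`BIJ88VertexExpansion311.terms`, kind `dchi z`) carries the factor `∂_zχ` under its Gaussian integral; if
`(∂_zχ)e^{−V}` is bounded by `K z` and `χ′` vanishes off a measurable SHELL `Sh` (in the model: some restricted field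
within the width of the cutoff from its threshold), then
`|∫ Π_{pend}Φ·(∂_zχ)e^{−V}dμ| ≤ √(∫ Π_{pend}Φ² dμ) · K z · √(μ(Sh))` — the shell measure `μ(Sh)` is the printed small
factor (Gaussian tail of the shell; p36's `BIJ88GaussShell*` in the model), kept displayed here.

statement-level skeleton of published theorems with citation tags; proofs where landed; nothing here is a claim
about the Yang–Mills mass gap

PDF held: `paper:balaban1988-cmp114-bij-abelian-higgs-effective-action` (journal page = PDF page + 256); p. 309, 311–312 =
PDF 53, 55–56.

CITATION HEADER (lean-in-tree rule).  lit-balaban cell (HOME `run/shared/lean/pub/lit-balaban/`), Phase 2, seat p25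
gen 15; row **C2.Claim@312** of `HOME/lit-balaban-r16/ROWS-C2-part2.md` (owner r16, referee ref-5; head untouched —
toward flip-path item (γ): with `BIJ88VertexRemainder312` both kinds of remainder terms of the one-component expansion
now carry an explicit small factor: `cap` ⇒ `c_M^{m̄+1}`, `χ′` ⇒ `√μ(shell)`).  USED BY NAME, nothing restated:
`BIJ88VertexIbp311.{lmono, vexp, lmono_append, continuous_lmono, integrable_lmono, continuous_vexp}`,
`BIJ88VertexExpansion311.{terms, Kind, tint, coef_bound}`, `BIJ88VertexRemainder312.abs_sum_dchi_le`, p13's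
`BIJ88IntegrationByParts305.integrable_bdd_mul_weight_source`, `B2Eq228Conditioning.{weight, source, weight_pos,
source_pos, continuous_weight, continuous_source}`; Mathlib's Hölder `integral_mul_le_Lp_mul_Lq_of_nonneg`.

## What is proved (0 `sorry`, standard axioms, no new `Prop` facts, theorems only)
* `abs_integral_mul_le_shell` — Cauchy–Schwarz with a support against `e^{−½⟨Φ,AΦ⟩}e^{⟨ℱ,Φ⟩}dΦ`;
* `abs_dchi_integral_le_shell` — the `χ′`-term bound displayed above;
* `abs_sum_dchi_le_shell` — summed over the `χ′`-terms of `terms L b` with `coef_bound`: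
  `|Σ_χ′| ≤ (max B 1)^{|L|+1+bD} · √(μ(Sh)) · Σ_{χ′-terms} c_M^{nv}·K z·√(∫Π_{pend}Φ² dμ)`.
HONEST SCOPE: one component, one covariance; the shell `Sh` and the bounds `K z` are hypotheses (which fields the
cutoffs restrict and the Gaussian smallness of the shell are the model's: p36's `BIJ88GaussShellCutoffs309` /
`BIJ88GaussShellModulus309`); the Gaussian moments `∫Π²dμ` and the number of terms are not bounded here.  NOT summit
progress; NOT continuum; NOT Clay.  Imports `BIJ88VertexRemainder312` and `Mathlib.MeasureTheory.Function.L2Space`;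
modifies nothing.
-/

noncomputable section

namespace Literature.MathematicalPhysics.QuantumFieldTheory.BalabanImbrieJaffe1984to88.BIJ88VertexChiShell312

open MeasureTheory Matrix Finset
open scoped BigOperators
open Literature.MathematicalPhysics.QuantumFieldTheory.Balaban1983to89
open B2Eq228Conditioning (weight source weight_pos source_pos continuous_weight continuous_source)
open BIJ88IntegrationByParts305 (integrable_bdd_mul_weight_source)
open BIJ88VertexIbp311 (lmono vexp lmono_append continuous_lmono integrable_lmono continuous_vexp)
open BIJ88VertexExpansion311 (Kind Term terms tint coef_bound)
open BIJ88VertexRemainder312 (abs_sum_dchi_le)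

variable {S : Type} [Fintype S] [DecidableEq S]

/-- **Cauchy–Schwarz with a support**: for `P` with `P²` integrable against the density, `g` measurable with `|g| ≤ K`
vanishing off a measurable set `Sh` (the shell where `χ′ ≠ 0`),
`|∫ P·g·dμ| ≤ √(∫ P² dμ) · (K · √(∫ 𝟙_{Sh} dμ))`, `dμ = e^{−½⟨Φ,AΦ⟩}e^{⟨ℱ,Φ⟩}dΦ`. [folklore] [cite: BalabanImbrieJaffe1988, §5.14 p.312] -/
theorem abs_integral_mul_le_shell {A : Matrix S S ℝ} (hA : A.PosDef) (f : S → ℝ) {P g : (S → ℝ) → ℝ}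
    (hPc : Continuous P) (hPi : Integrable fun φ : S → ℝ => P φ ^ 2 * (weight A φ * source f φ))
    (hgm : AEStronglyMeasurable g volume) {K : ℝ} (hK : ∀ φ, |g φ| ≤ K) {Sh : Set (S → ℝ)}
    (hSh : MeasurableSet Sh) (hgS : ∀ φ, φ ∉ Sh → g φ = 0) :
    |∫ φ : S → ℝ, P φ * g φ * (weight A φ * source f φ)|
      ≤ Real.sqrt (∫ φ : S → ℝ, P φ ^ 2 * (weight A φ * source f φ))
        * (K * Real.sqrt (∫ φ : S → ℝ, Sh.indicator (fun _ => (1 : ℝ)) φ * (weight A φ * source f φ))) := by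
  set d : (S → ℝ) → ℝ := fun φ => weight A φ * source f φ with hd
  have hdpos : ∀ φ, 0 < d φ := fun φ => mul_pos (weight_pos A φ) (source_pos f φ)
  have hdc : Continuous d := (continuous_weight A).mul (continuous_source f)
  have hK0 : 0 ≤ K := (abs_nonneg _).trans (hK (fun _ => 0))
  -- the two square-integrable factors
  set F : (S → ℝ) → ℝ := fun φ => |P φ| * Real.sqrt (d φ) with hF
  set G : (S → ℝ) → ℝ := fun φ => |g φ| * Real.sqrt (d φ) with hG
  have hFm : AEStronglyMeasurable F volume :=
    ((hPc.abs).mul (hdc.sqrt)).aestronglyMeasurable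
  have hGm : AEStronglyMeasurable G volume := by
    have : AEStronglyMeasurable (fun φ => |g φ|) volume := hgm.norm.congr (by simp [Real.norm_eq_abs])
    exact this.mul hdc.sqrt.aestronglyMeasurable
  have hF2 : ∀ φ, F φ ^ 2 = P φ ^ 2 * d φ := fun φ => by
    rw [hF]; dsimp only
    rw [mul_pow, sq_abs, Real.sq_sqrt (hdpos φ).le]
  have hG2 : ∀ φ, G φ ^ 2 = g φ ^ 2 * d φ := fun φ => by
    rw [hG]; dsimp only
    rw [mul_pow, sq_abs, Real.sq_sqrt (hdpos φ).le]
  have hIndI : Integrable fun φ : S → ℝ => Sh.indicator (fun _ => (1 : ℝ)) φ * d φ := by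
    refine integrable_bdd_mul_weight_source hA f
      ((aestronglyMeasurable_const.indicator hSh)) (K := 1) fun φ => ?_
    by_cases h : φ ∈ Sh <;> simp [h]
  have hG2i : Integrable fun φ : S → ℝ => G φ ^ 2 := by
    have hb : Integrable fun φ : S → ℝ => K ^ 2 * (Sh.indicator (fun _ => (1 : ℝ)) φ * d φ) := hIndI.const_mul _
    refine hb.mono' (hGm.pow 2) (Filter.Eventually.of_forall fun φ => ?_)
    rw [Real.norm_eq_abs, hG2, abs_of_nonneg (mul_nonneg (sq_nonneg _) (hdpos φ).le)]
    by_cases h : φ ∈ Sh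
    · simp only [h, Set.indicator_of_mem, one_mul]
      exact mul_le_mul_of_nonneg_right (by
        have := hK φ
        nlinarith [abs_nonneg (g φ), sq_abs (g φ)]) (hdpos φ).le
    · rw [hgS φ h, Set.indicator_of_notMem h]
      simp
  have hF2i : Integrable fun φ : S → ℝ => F φ ^ 2 := hPi.congr (Filter.Eventually.of_forall fun φ => (hF2 φ).symm)
  have hFp : MemLp F (ENNReal.ofReal 2) volume := by
    rw [show ENNReal.ofReal 2 = 2 by norm_num]
    exact (memLp_two_iff_integrable_sq hFm).2 hF2i
  have hGp : MemLp G (ENNReal.ofReal 2) volume := by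
    rw [show ENNReal.ofReal 2 = 2 by norm_num]
    exact (memLp_two_iff_integrable_sq hGm).2 hG2i
  have hH := integral_mul_le_Lp_mul_Lq_of_nonneg Real.HolderConjugate.two_two
    (Filter.Eventually.of_forall fun φ => by positivity) (Filter.Eventually.of_forall fun φ => by positivity) hFp hGp
  -- |∫ P g d| ≤ ∫ F G
  have h1 : |∫ φ : S → ℝ, P φ * g φ * d φ| ≤ ∫ φ : S → ℝ, F φ * G φ := by
    refine (abs_integral_le_integral_abs).trans (le_of_eq (integral_congr_ae (Filter.Eventually.of_forall fun φ => ?_)))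
    dsimp only [hF, hG]
    rw [abs_mul, abs_mul, abs_of_pos (hdpos φ),
      show |P φ| * Real.sqrt (d φ) * (|g φ| * Real.sqrt (d φ)) = |P φ| * |g φ| * (Real.sqrt (d φ) * Real.sqrt (d φ))
        by ring, Real.mul_self_sqrt (hdpos φ).le]
  refine h1.trans (hH.trans ?_)
  -- identify the two L² norms
  have e1 : (∫ φ : S → ℝ, F φ ^ (2 : ℝ)) ^ (1 / (2 : ℝ)) = Real.sqrt (∫ φ : S → ℝ, P φ ^ 2 * d φ) := by
    rw [Real.sqrt_eq_rpow]
    congr 1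
    exact integral_congr_ae (Filter.Eventually.of_forall fun φ => by
      dsimp only; rw [Real.rpow_two, hF2])
  have e2 : (∫ φ : S → ℝ, G φ ^ (2 : ℝ)) ^ (1 / (2 : ℝ)) = Real.sqrt (∫ φ : S → ℝ, G φ ^ 2) := by
    rw [Real.sqrt_eq_rpow]
    congr 1
    exact integral_congr_ae (Filter.Eventually.of_forall fun φ => by dsimp only; rw [Real.rpow_two])
  rw [e1, e2]
  refine mul_le_mul_of_nonneg_left ?_ (Real.sqrt_nonneg _)
  -- √(∫ G²) ≤ K √(∫_{Sh} d)
  have hle : ∫ φ : S → ℝ, G φ ^ 2 ≤ K ^ 2 * ∫ φ : S → ℝ, Sh.indicator (fun _ => (1 : ℝ)) φ * d φ := by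
    rw [← integral_const_mul]
    refine integral_mono hG2i (hIndI.const_mul _) fun φ => ?_
    dsimp only
    rw [hG2]
    by_cases h : φ ∈ Sh
    · simp only [h, Set.indicator_of_mem, one_mul]
      exact mul_le_mul_of_nonneg_right (by
        have := hK φ
        nlinarith [abs_nonneg (g φ), sq_abs (g φ)]) (hdpos φ).le
    · rw [hgS φ h, Set.indicator_of_notMem h]
      simp
  calc Real.sqrt (∫ φ : S → ℝ, G φ ^ 2)
      ≤ Real.sqrt (K ^ 2 * ∫ φ : S → ℝ, Sh.indicator (fun _ => (1 : ℝ)) φ * d φ) := Real.sqrt_le_sqrt hle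
    _ = K * Real.sqrt (∫ φ : S → ℝ, Sh.indicator (fun _ => (1 : ℝ)) φ * d φ) := by
      rw [Real.sqrt_mul (sq_nonneg K), Real.sqrt_sq hK0]


variable {ι : Type} [Fintype ι]

/-- **THE `χ′`-TERM BOUND** — *"contractions to χ′ … remainder components"*: for a term whose cutoff factor is `∂_zχ`,
`|∫ Π_{pend}Φ·(∂_zχ)e^{−V} dμ| ≤ √(∫ Π_{pend}Φ² dμ) · (K z · √(μ(Sh)))` when `|(∂_zχ)e^{−V}| ≤ K z` and `Dχ = 0` off the
shell `Sh`. [cite: BalabanImbrieJaffe1988, §5.14 p.311–312] -/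
theorem abs_dchi_integral_le_shell {A : Matrix S S ℝ} (hA : A.PosDef) (f : S → ℝ) (c : ι → ℝ)
    (legs : ι → List (S → ℝ)) {χ : (S → ℝ) → ℝ} (hχ : ContDiff ℝ 1 χ) {K : (S → ℝ) → ℝ}
    (hK : ∀ z φ, |fderiv ℝ χ φ z * vexp c legs φ| ≤ K z) {Sh : Set (S → ℝ)} (hSh : MeasurableSet Sh)
    (hχS : ∀ φ, φ ∉ Sh → fderiv ℝ χ φ = 0) (L : List (S → ℝ)) (z : S → ℝ) :
    |∫ φ : S → ℝ, lmono L φ * (fderiv ℝ χ φ z * vexp c legs φ) * (weight A φ * source f φ)|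
      ≤ Real.sqrt (∫ φ : S → ℝ, lmono (L ++ L) φ * (weight A φ * source f φ))
        * (K z * Real.sqrt (∫ φ : S → ℝ, Sh.indicator (fun _ => (1 : ℝ)) φ * (weight A φ * source f φ))) := by
  have hPi : Integrable fun φ : S → ℝ => lmono L φ ^ 2 * (weight A φ * source f φ) := by
    have h := integrable_lmono hA f (H := fun _ => (1 : ℝ)) continuous_const (K := 1) (fun _ => by simp) (L ++ L)
    refine h.congr (Filter.Eventually.of_forall fun φ => ?_)
    simp only [lmono_append, mul_one, sq]
  have hgm : AEStronglyMeasurable (fun φ : S → ℝ => fderiv ℝ χ φ z * vexp c legs φ) volume :=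
    (((hχ.continuous_fderiv one_ne_zero).clm_apply continuous_const).mul (continuous_vexp c legs)).aestronglyMeasurable
  have h := abs_integral_mul_le_shell hA f (continuous_lmono L) hPi hgm (hK z) hSh
    (fun φ hφ => by simp [hχS φ hφ])
  refine h.trans (le_of_eq ?_)
  congr 2
  exact integral_congr_ae (Filter.Eventually.of_forall fun φ => by simp only [lmono_append, sq])

/-- **THE `χ′` SMALL FACTOR OF THE REMAINDER, SUMMED** (with `coef_bound`): brackets bounded by `B` on `Dir ⊇` legs and
vertex legs, `0 ≤ c_M`, `|c_m| ≤ c_M`, arities `≤ D`, `|(∂_zχ)e^{−V}| ≤ K z`, `Dχ = 0` off `Sh`: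
`|Σ_χ′| ≤ (max B 1)^{|L|+1+bD} · √(μ(Sh)) · Σ_{χ′-terms t} c_M^{nv t}·K z_t·√(∫Π_{pend t ++ pend t}Φ dμ)`.
[cite: BalabanImbrieJaffe1988, §5.14 p.312] -/
theorem abs_sum_dchi_le_shell {A : Matrix S S ℝ} (hA : A.PosDef) {f : S → ℝ} {c : ι → ℝ}
    {legs : ι → List (S → ℝ)} {χ : (S → ℝ) → ℝ} (hχ : ContDiff ℝ 1 χ) {Dir : Set (S → ℝ)} {B cM : ℝ}
    (hB : ∀ u ∈ Dir, ∀ v ∈ Dir, |(A⁻¹ *ᵥ u) ⬝ᵥ v| ≤ B) (hBf : ∀ u ∈ Dir, |(A⁻¹ *ᵥ u) ⬝ᵥ f| ≤ B) (hcM : 0 ≤ cM)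
    (hc : ∀ m, |c m| ≤ cM) (hlegs : ∀ m, ∀ w ∈ legs m, w ∈ Dir) {D : ℕ} (hD : ∀ m, (legs m).length ≤ D)
    {K : (S → ℝ) → ℝ} (hK : ∀ z φ, |fderiv ℝ χ φ z * vexp c legs φ| ≤ K z) {Sh : Set (S → ℝ)}
    (hSh : MeasurableSet Sh) (hχS : ∀ φ, φ ∉ Sh → fderiv ℝ χ φ = 0) {L : List (S → ℝ)} (hL : ∀ w ∈ L, w ∈ Dir)
    (b : ℕ) :
    |((terms A f c legs L b).map fun t => match t.kind with | .dchi _ => tint A f χ c legs t | _ => 0).sum|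
      ≤ (max B 1) ^ (L.length + 1 + b * D)
        * Real.sqrt (∫ φ : S → ℝ, Sh.indicator (fun _ => (1 : ℝ)) φ * (weight A φ * source f φ))
        * ((terms A f c legs L b).map fun t => match t.kind with
            | .dchi z => cM ^ t.nv * K z * Real.sqrt (∫ φ : S → ℝ, lmono (t.pend ++ t.pend) φ * (weight A φ * source f φ))
            | _ => 0).sum := by
  refine (abs_sum_dchi_le χ hB hBf hcM hc hlegs hD hL b).trans ?_
  conv_rhs => rw [mul_assoc, ← List.sum_map_mul_left]
  refine mul_le_mul_of_nonneg_left (List.sum_le_sum fun t _ => ?_) (pow_nonneg (zero_le_one.trans (le_max_right B 1)) _)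
  rcases t.kind with _ | z | _
  · simp
  · dsimp only
    have h := abs_dchi_integral_le_shell hA f c legs hχ hK hSh hχS t.pend z
    calc cM ^ t.nv * |∫ φ : S → ℝ, lmono t.pend φ * (fderiv ℝ χ φ z * vexp c legs φ) * (weight A φ * source f φ)|
        ≤ cM ^ t.nv * (Real.sqrt (∫ φ : S → ℝ, lmono (t.pend ++ t.pend) φ * (weight A φ * source f φ))
          * (K z * Real.sqrt (∫ φ : S → ℝ, Sh.indicator (fun _ => (1 : ℝ)) φ * (weight A φ * source f φ)))) :=
          mul_le_mul_of_nonneg_left h (pow_nonneg hcM _)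
      _ = _ := by ring
  · simp

end Literature.MathematicalPhysics.QuantumFieldTheory.BalabanImbrieJaffe1984to88.BIJ88VertexChiShell312
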